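import Summits.QuantumFields.YangMills.Theorems.BalabanUVNodesN16ApproximateSchemeTransfer
import HarnessLib

/-!
# YM-DAG node N16 (NE3), the located averaging pin (42) ↔ (0.4) — part 27′: THE APPROXIMATE TRANSFER PRINCIPLE WITH THE GAUGE GROUP A PARAMETER `Γ ≤ (M_n ℂ)ˣ`
# (part 27 = `Γ = U(N)`; `Γ = SU(N)` is the typing the (0.4) side of record requires — part 23's divergence (d1))

Cell `pub-ymgap`, width seat `pub-ymgap-dag-n16-w3` (director-ym №197 ∕ HUMAN RULING D-0149), generation 9; companion of part 27 p641437 `…N16ApproximateSchemeTransfer`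
(`CfgNear`, `ApproxSchemeGaugeEquiv`, `RightInverseModulus`, `exists_admissibleS_le_add`, …).  `--supports stmt-QuantumFields-27366 --as helper` (K3⁸, KEY MAP v2; count-neutral).

WHY.  Part 27 (like part 14) quantifies the coarse gauges over ALL unitary `U(N)`-valued site fields and asks the class to be invariant under them.  For the (0.4) scheme OF
RECORD read on the B7 fold (g0's `step04 F N = lift ∘ avOfRecord.avg ∘ descendSU`) this typing is WRONG: `descendSU` reads the `SU(N)`-part (junk `1` off `SU(N)`, divergence
(d1)), a `U(N)`-valued gauge moves `SU(N)`-valued data off `SU(N)`, and part 23's centre witness kills every `U(N)`-typed criterion at order zero.  The (0.4) side must be typed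
over `SU(N)`-VALUED classes with `SU(N)`-VALUED gauges (part 23, KEY FINDING (4) of g8).  This file makes the gauge group a PARAMETER: a subgroup `Γ` of the units of `M_n(ℂ)`
contained in the unitary units (`hΓ : Γ ≤ unitaryUnits`), classes invariant under `Γ`-valued periodic gauges only.
 * §1 `ApproxSchemeGaugeEquivIn d Γ s₁ s₂ L N k C δ` — part 27's (H1) with `Γ`-valued gauges in (cov₁)∕(cov₂)∕(defect); `Γ = U(N)` ⟺ part 27's structure
   (`approxIn_unitaryUnits_iff`, `…_zero_iff` ⟺ part 14); monotone, restricts, symmetric and transitive (for `Γ` unitary: inverses and products stay in `Γ`).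
 * §2 ★★ the transfer theorems of part 27 §4 VERBATIM with `Γ`: `exists_admissibleS_le_add`, `nonempty_admissibleS_of_approx`, `levelAction_isMinimiserS_le_add`,
   `abs_levelAction_isMinimiserS_sub_le`, `sInf_levelAction_admissibleS_le_add`, ★★ `abs_sInf_sub_sInf_le`, ★★ `abs_sInf_admissibleS_sub_minAct_le` — (H2) `RightInverseModulus`
   is part 27's (no gauge in it); the competitor `U^{lift κ_U⁻¹}` stays in the class because `κ_U⁻¹` is `Γ`-valued; norms are gauge invariant because `Γ` is unitary.
READING.  For `Γ = SU(N)`-units and `SU(N)`-valued gauge-invariant sub-classes of `sfClass` these are the statements a (0.4)-side road can instantiate; for `Γ = U(N)` they are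
part 27's.  Nothing of the (0.4) scheme is proved here; no class is shown `Γ`-invariant here (pub-balaban's `mem_sfClass_gaugeAct` gives the `U(N)` case).

HONEST FRAMING.  [folklore] bookkeeping BY NAME over part 27 (proof texts identical up to the subgroup bookkeeping); one Prop-valued hypothesis SHAPE (`ApproxSchemeGaugeEquivIn`)
asserted for nothing; 0 `sorry`, no `instance`, no `notation`; NO estimate; no minimiser constructed; nothing of [Balaban1985Variational] ∕ [Balaban1987RG1] asserted; K3⁸ stubs
`stub_rates13HV` ∕ `stub_expansion13HV` NOT touched; N16 ∕ NE3 NOT discharged; count-neutral (typed 28∕28 · discharged 5∕27 work-bound, A 5∕28 — unmoved).  One finite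
four-torus programme at fixed `ε` — the Yang–Mills mass gap (Clay) is NOT proved by any of this; R4 closes the conditional finite-𝕋⁴ rung `BalabanLadder.UV` only; nothing
continuum ∕ ℝ⁴ ∕ OS.
-/

set_option autoImplicit false

open scoped BigOperators Matrix Matrix.Norms.L2Operator
open NormedSpace

namespace Summit.QuantumFields.YangMills.BalabanUVNodes.N16ApproximateSchemeTransferSub

open Literature.MathematicalPhysics.QuantumFieldTheory.Balaban1983to89
open B7Prop1Explicit B7Prop2Explicit
open Summit.QuantumFields.BalabanUV.T4Continuum
open MinimalActionLevels (levelAction)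
open MinimalActionSandwich (admissible minAct IsMinimiser)
open NE3EnergyShapes (IsUnitarySite IsPeriodicSite)
open AveragingDeficitKDatum (gaugeAct_inv_gaugeAct)
open NE7EtaMinimiserGaugeCovariance (levelAction_gaugeAct isUnitarySite_inv isPeriodicSite_inv)
open Summit.QuantumFields.YangMills.BalabanUVNodes.N16AveragingPin (avgIterS step42 avgIterS_step42 admissibleS mem_admissibleS_iff admissibleS_step42 IsMinimiserS)
open Summit.QuantumFields.YangMills.BalabanUVNodes.N16AveragingTransferOfGaugeDefect (isPeriodicSite_blockLift)
open Summit.QuantumFields.YangMills.BalabanUVNodes.N16CentreConventionTransfer (SchemeGaugeEquiv gaugeAct_gaugeAct)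
open Summit.QuantumFields.YangMills.BalabanUVNodes.N16ApproximateSchemeTransfer
  (CfgNear cfgNear_refl CfgNear.gaugeAct CfgNear.triangle CfgNear.mono CfgNear.eq_of_zero ApproxSchemeGaugeEquiv approx_zero_iff RightInverseModulus
    bddBelow_levelAction_image_admissibleS)

noncomputable section

variable {d : ℕ} {n : Type*} [Fintype n] [DecidableEq n]

/-! ## §1 Approximate coarse-gauge equivalence with gauges in a subgroup `Γ` -/

section ApproxIn

variable (d) in
/-- **APPROXIMATE COARSE-GAUGE EQUIVALENCE WITH GAUGES IN A SUBGROUP `Γ`** — part 27's `ApproxSchemeGaugeEquiv` with the gauge group a PARAMETER `Γ ≤ (M_n ℂ)ˣ`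
(`Γ = U(N)`: part 27 verbatim, `approxIn_unitaryUnits_iff`; `Γ = SU(N)`: the typing the (0.4) side needs, part 23's (d1)): (cov₁)∕(cov₂) block lifts of `Γ`-valued `N`-periodic
coarse gauges move the two `k`-fold averages covariantly on `C`, and (defect) for every `U ∈ C` there is a `Γ`-valued `N`-periodic coarse gauge `κ_U` with the `s₂`-average of
`U` bondwise `δ`-close to the `κ_U`-transform of its `s₁`-average.  A hypothesis SHAPE, asserted for no pair of schemes. [folklore] -/
@[folklore]
structure ApproxSchemeGaugeEquivIn (Γ : Subgroup (Matrix n n ℂ)ˣ) (s₁ s₂ : ℕ → (Site d → Fin d → (Matrix n n ℂ)ˣ) → (Site d → Fin d → (Matrix n n ℂ)ˣ)) (L N k : ℕ)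
    (C : Set (Site d → Fin d → (Matrix n n ℂ)ˣ)) (δ : ℝ) : Prop where
  /-- (cov₁) block lifts move `s₁`'s `k`-fold average by `κ` -/
  cov₁ : ∀ (κ : Site d → (Matrix n n ℂ)ˣ) (U : Site d → Fin d → (Matrix n n ℂ)ˣ), (∀ x, κ x ∈ Γ) → IsPeriodicSite κ (N : ℤ) → U ∈ C →
    avgIterS s₁ k (gaugeAct (fun x : Site d => κ (fun i => x i / (L : ℤ) ^ k)) U) = gaugeAct κ (avgIterS s₁ k U)
  /-- (cov₂) block lifts move `s₂`'s `k`-fold average by `κ` -/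
  cov₂ : ∀ (κ : Site d → (Matrix n n ℂ)ˣ) (U : Site d → Fin d → (Matrix n n ℂ)ˣ), (∀ x, κ x ∈ Γ) → IsPeriodicSite κ (N : ℤ) → U ∈ C →
    avgIterS s₂ k (gaugeAct (fun x : Site d => κ (fun i => x i / (L : ℤ) ^ k)) U) = gaugeAct κ (avgIterS s₂ k U)
  /-- (defect) on `C` the two `k`-fold averages are `δ`-close up to a unitary `N`-periodic coarse gauge -/
  defect : ∀ U ∈ C, ∃ κ : Site d → (Matrix n n ℂ)ˣ, (∀ x, κ x ∈ Γ) ∧ IsPeriodicSite κ (N : ℤ) ∧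
    CfgNear δ (avgIterS s₂ k U) (gaugeAct κ (avgIterS s₁ k U))

variable {Γ : Subgroup (Matrix n n ℂ)ˣ} {s₁ s₂ s₃ : ℕ → (Site d → Fin d → (Matrix n n ℂ)ˣ) → (Site d → Fin d → (Matrix n n ℂ)ˣ)} {L N k : ℕ}
  {C C' : Set (Site d → Fin d → (Matrix n n ℂ)ˣ)} {δ δ' δ₁ δ₂ : ℝ}

/-- **PART 27's STRUCTURE IS THE CASE `Γ = U(N)`** (`IsUnitarySite κ` unfolds to `∀ x, κ x ∈ unitaryUnits`). [folklore] -/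
theorem approxIn_unitaryUnits_iff :
    ApproxSchemeGaugeEquivIn d (unitaryUnits (Matrix n n ℂ)) s₁ s₂ L N k C δ ↔ ApproxSchemeGaugeEquiv d s₁ s₂ L N k C δ :=
  ⟨fun h => { cov₁ := h.cov₁, cov₂ := h.cov₂, defect := h.defect }, fun h => { cov₁ := h.cov₁, cov₂ := h.cov₂, defect := h.defect }⟩

/-- At `δ = 0` with `Γ = U(N)` it is part 14's exact criterion (part 27's `approx_zero_iff`). [folklore] -/
theorem approxIn_unitaryUnits_zero_iff :
    ApproxSchemeGaugeEquivIn d (unitaryUnits (Matrix n n ℂ)) s₁ s₂ L N k C 0 ↔ SchemeGaugeEquiv d s₁ s₂ L N k C :=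
  approxIn_unitaryUnits_iff.trans approx_zero_iff

/-- Monotone in the defect. [folklore] -/
theorem ApproxSchemeGaugeEquivIn.mono (h : ApproxSchemeGaugeEquivIn d Γ s₁ s₂ L N k C δ) (hδ : δ ≤ δ') : ApproxSchemeGaugeEquivIn d Γ s₁ s₂ L N k C δ' where
  cov₁ := h.cov₁
  cov₂ := h.cov₂
  defect U hU := by
    obtain ⟨κ, hκ, hκP, hdef⟩ := h.defect U hU
    exact ⟨κ, hκ, hκP, hdef.mono hδ⟩

/-- Restricts to sub-classes. [folklore] -/
theorem ApproxSchemeGaugeEquivIn.of_subset (h : ApproxSchemeGaugeEquivIn d Γ s₁ s₂ L N k C δ) (hC' : C' ⊆ C) : ApproxSchemeGaugeEquivIn d Γ s₁ s₂ L N k C' δ where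
  cov₁ κ U hκ hκP hU := h.cov₁ κ U hκ hκP (hC' hU)
  cov₂ κ U hκ hκP hU := h.cov₂ κ U hκ hκP (hC' hU)
  defect U hU := h.defect U (hC' hU)

/-- **SYMMETRIC** with the same defect (for `Γ` unitary): the inverse gauge `κ_U⁻¹` (part 27 §1's gauge invariance of closeness + `gaugeAct_inv_gaugeAct`). [folklore] -/
theorem ApproxSchemeGaugeEquivIn.symm (h : ApproxSchemeGaugeEquivIn d Γ s₁ s₂ L N k C δ) (hΓ : Γ ≤ unitaryUnits (Matrix n n ℂ)) :
    ApproxSchemeGaugeEquivIn d Γ s₂ s₁ L N k C δ where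
  cov₁ := h.cov₂
  cov₂ := h.cov₁
  defect U hU := by
    obtain ⟨κ, hκ, hκP, hdef⟩ := h.defect U hU
    refine ⟨fun w => (κ w)⁻¹, fun w => Γ.inv_mem (hκ w), isPeriodicSite_inv hκP, ?_⟩
    have h' := hdef.gaugeAct (isUnitarySite_inv fun x => hΓ (hκ x))
    rw [gaugeAct_inv_gaugeAct] at h'
    exact h'.symm

/-- **TRANSITIVE, DEFECTS ADD** (for `Γ` unitary): the data-dependent gauges multiply in `Γ` and the radii add. [folklore] -/
theorem ApproxSchemeGaugeEquivIn.trans (h₁₂ : ApproxSchemeGaugeEquivIn d Γ s₁ s₂ L N k C δ₁) (h₂₃ : ApproxSchemeGaugeEquivIn d Γ s₂ s₃ L N k C δ₂)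
    (hΓ : Γ ≤ unitaryUnits (Matrix n n ℂ)) : ApproxSchemeGaugeEquivIn d Γ s₁ s₃ L N k C (δ₁ + δ₂) where
  cov₁ := h₁₂.cov₁
  cov₂ := h₂₃.cov₂
  defect U hU := by
    obtain ⟨κ, hκ, hκP, h⟩ := h₁₂.defect U hU
    obtain ⟨κ', hκ', hκ'P, h'⟩ := h₂₃.defect U hU
    refine ⟨fun z => κ' z * κ z, fun z => Γ.mul_mem (hκ' z) (hκ z), fun z i => ?_, ?_⟩
    · show κ' (z + (N : ℤ) • e i) * κ (z + (N : ℤ) • e i) = κ' z * κ z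
      rw [hκ'P z i, hκP z i]
    · have h'' : CfgNear δ₁ (gaugeAct κ' (avgIterS s₂ k U)) (gaugeAct (fun z => κ' z * κ z) (avgIterS s₁ k U)) := by
        rw [← gaugeAct_gaugeAct]
        exact h.gaugeAct fun x => hΓ (hκ' x)
      have := h'.triangle h''
      rwa [add_comm] at this

end ApproxIn

/-! ## §2 The transfer theorems with gauges in `Γ` -/

section TransferIn

variable {Γ : Subgroup (Matrix n n ℂ)ˣ} {s s₁ s₂ : ℕ → (Site d → Fin d → (Matrix n n ℂ)ˣ) → (Site d → Fin d → (Matrix n n ℂ)ˣ)}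
  {𝒞 : ℕ → Set (Site d → Fin d → (Matrix n n ℂ)ˣ)} {L N k : ℕ} {D : Set (Site d → Fin d → (Matrix n n ℂ)ˣ)} {δ ω : ℝ}

/-! The standing hypotheses: `Γ ≤ U(N)`, `1 ≤ L`, and the class `𝒞 k` is invariant under `Γ`-valued `(N·L^k)`-periodic gauges. -/
variable (hΓ : Γ ≤ unitaryUnits (Matrix n n ℂ)) (hL : 1 ≤ L)
  (hC : ∀ (u : Site d → (Matrix n n ℂ)ˣ) (U : Site d → Fin d → (Matrix n n ℂ)ˣ), (∀ x, u x ∈ Γ) →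
    IsPeriodicSite u ((N * L ^ k : ℕ) : ℤ) → U ∈ 𝒞 k → gaugeAct u U ∈ 𝒞 k)
include hΓ hL hC

/-- **★★ THE COMPETITOR**: on a class invariant under unitary `(N·L^k)`-periodic gauges, under (H1) `ApproxSchemeGaugeEquivIn d Γ s₁ s₂ L N k (𝒞 k) δ` and (H2)
`RightInverseModulus d s₂ 𝒞 L N k D δ ω`, every `s₁`-admissible `U` at a datum `V ∈ D` has an `s₂`-admissible `U′` AT THE SAME DATUM with `A^{(k)}(U′) ≤ A^{(k)}(U) + ω`.
Mechanism: the gauge transform `U^{lift κ_U⁻¹}` lies in the class, has the same action (`levelAction_gaugeAct`) and — by (cov₂), §1's gauge invariance and `avgIterS s₁ k U = V` —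
its `s₂`-average is `δ`-close to `V` itself; (H2) corrects it to datum `V`. [folklore] -/
theorem exists_admissibleS_le_add (hE : ApproxSchemeGaugeEquivIn d Γ s₁ s₂ L N k (𝒞 k) δ) (hR : RightInverseModulus d s₂ 𝒞 L N k D δ ω)
    {V : Site d → Fin d → (Matrix n n ℂ)ˣ} (hV : V ∈ D) {U : Site d → Fin d → (Matrix n n ℂ)ˣ} (hU : U ∈ admissibleS s₁ 𝒞 k V) :
    ∃ U' ∈ admissibleS s₂ 𝒞 k V, levelAction d L N k U' ≤ levelAction d L N k U + ω := by
  obtain ⟨hUC, hUV⟩ := hU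
  obtain ⟨κ, hκ, hκP, hnear⟩ := hE.defect U hUC
  have hκiΓ : ∀ z, (κ z)⁻¹ ∈ Γ := fun z => Γ.inv_mem (hκ z)
  have hκi : IsUnitarySite (fun z => (κ z)⁻¹) := isUnitarySite_inv fun x => hΓ (hκ x)
  have hκiP : IsPeriodicSite (fun z => (κ z)⁻¹) (N : ℤ) := isPeriodicSite_inv hκP
  have hU₁C : gaugeAct (fun x : Site d => (κ (fun i => x i / (L : ℤ) ^ k))⁻¹) U ∈ 𝒞 k :=
    hC _ U (fun x => hκiΓ _) (isPeriodicSite_blockLift L hL k hκiP) hUC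
  have havg : avgIterS s₂ k (gaugeAct (fun x : Site d => (κ (fun i => x i / (L : ℤ) ^ k))⁻¹) U)
      = gaugeAct (fun z => (κ z)⁻¹) (avgIterS s₂ k U) := hE.cov₂ (fun z => (κ z)⁻¹) U hκiΓ hκiP hUC
  have hnear' : CfgNear δ (avgIterS s₂ k (gaugeAct (fun x : Site d => (κ (fun i => x i / (L : ℤ) ^ k))⁻¹) U)) V := by
    rw [havg]
    have h' := hnear.gaugeAct hκi
    rwa [hUV, gaugeAct_inv_gaugeAct] at h'
  obtain ⟨U', hU', hle⟩ := hR V hV _ hU₁C hnear'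
  exact ⟨U', hU', by rwa [levelAction_gaugeAct] at hle⟩

/-- **ADMISSIBILITY TRANSFERS**: under (H1)+(H2) an `s₁`-admissible datum of `D` is `s₂`-admissible. [folklore] -/
theorem nonempty_admissibleS_of_approx (hE : ApproxSchemeGaugeEquivIn d Γ s₁ s₂ L N k (𝒞 k) δ) (hR : RightInverseModulus d s₂ 𝒞 L N k D δ ω)
    {V : Site d → Fin d → (Matrix n n ℂ)ˣ} (hV : V ∈ D) (hne : (admissibleS s₁ 𝒞 k V).Nonempty) : (admissibleS s₂ 𝒞 k V).Nonempty := by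
  obtain ⟨U, hU⟩ := hne
  obtain ⟨U', hU', -⟩ := exists_admissibleS_le_add hΓ hL hC hE hR hV hU
  exact ⟨U', hU'⟩

/-- **★ MINIMISER FORM, ONE SIDE**: an `s₂`-minimiser at `V` costs at most `ω` more than any `s₁`-admissible configuration at `V` (a fortiori than an `s₁`-minimiser). [folklore] -/
theorem levelAction_isMinimiserS_le_add (hE : ApproxSchemeGaugeEquivIn d Γ s₁ s₂ L N k (𝒞 k) δ) (hR : RightInverseModulus d s₂ 𝒞 L N k D δ ω)
    {V U₁ U₂ : Site d → Fin d → (Matrix n n ℂ)ˣ} (hV : V ∈ D) (hU₁ : U₁ ∈ admissibleS s₁ 𝒞 k V) (h₂ : IsMinimiserS d s₂ 𝒞 L N k V U₂) :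
    levelAction d L N k U₂ ≤ levelAction d L N k U₁ + ω := by
  obtain ⟨U', hU', hle⟩ := exists_admissibleS_le_add hΓ hL hC hE hR hV hU₁
  exact (h₂.le U' hU').trans hle

/-- **★★ MINIMISER FORM, TWO SIDES**: with (H2) for BOTH schemes, minimisers `U₁, U₂` of the two constrained problems at the same datum `V ∈ D` have
`|A^{(k)}(U₁) − A^{(k)}(U₂)| ≤ ω` ((H1) is symmetric, §2). [folklore] -/
theorem abs_levelAction_isMinimiserS_sub_le (hE : ApproxSchemeGaugeEquivIn d Γ s₁ s₂ L N k (𝒞 k) δ)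
    (hR₁ : RightInverseModulus d s₁ 𝒞 L N k D δ ω) (hR₂ : RightInverseModulus d s₂ 𝒞 L N k D δ ω)
    {V U₁ U₂ : Site d → Fin d → (Matrix n n ℂ)ˣ} (hV : V ∈ D) (h₁ : IsMinimiserS d s₁ 𝒞 L N k V U₁) (h₂ : IsMinimiserS d s₂ 𝒞 L N k V U₂) :
    |levelAction d L N k U₁ - levelAction d L N k U₂| ≤ ω := by
  have a := levelAction_isMinimiserS_le_add hΓ hL hC hE hR₂ hV h₁.mem h₂
  have b := levelAction_isMinimiserS_le_add hΓ hL hC (hE.symm hΓ) hR₁ hV h₂.mem h₁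
  rw [abs_le]
  constructor <;> linarith

/-- **★ INF FORM, ONE SIDE**: `inf A^{(k)}(admissibleS s₂ 𝒞 k V) ≤ inf A^{(k)}(admissibleS s₁ 𝒞 k V) + ω` for an `s₁`-admissible datum `V ∈ D`, the `s₂`-side image bounded
below.  No minimiser assumed. [folklore] -/
theorem sInf_levelAction_admissibleS_le_add (hE : ApproxSchemeGaugeEquivIn d Γ s₁ s₂ L N k (𝒞 k) δ) (hR : RightInverseModulus d s₂ 𝒞 L N k D δ ω)
    {V : Site d → Fin d → (Matrix n n ℂ)ˣ} (hV : V ∈ D) (hne : (admissibleS s₁ 𝒞 k V).Nonempty)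
    (hbdd : BddBelow (levelAction d L N k '' admissibleS s₂ 𝒞 k V)) :
    sInf (levelAction d L N k '' admissibleS s₂ 𝒞 k V) ≤ sInf (levelAction d L N k '' admissibleS s₁ 𝒞 k V) + ω := by
  rw [← sub_le_iff_le_add]
  refine le_csInf (hne.image _) ?_
  rintro _ ⟨U, hU, rfl⟩
  obtain ⟨U', hU', hle⟩ := exists_admissibleS_le_add hΓ hL hC hE hR hV hU
  have h := csInf_le hbdd (Set.mem_image_of_mem _ hU')
  linarith

/-- **★★ INF FORM, TWO SIDES**: with (H2) for both schemes, on a class with a level-action lower bound and an `s₁`-admissible datum `V ∈ D`,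
`|inf A^{(k)}(admissibleS s₁ 𝒞 k V) − inf A^{(k)}(admissibleS s₂ 𝒞 k V)| ≤ ω` — THE END NUMBERS OF THE TWO CONSTRAINED PROBLEMS AGREE TO WITHIN THE MODULUS. [folklore] -/
theorem abs_sInf_sub_sInf_le (hE : ApproxSchemeGaugeEquivIn d Γ s₁ s₂ L N k (𝒞 k) δ)
    (hR₁ : RightInverseModulus d s₁ 𝒞 L N k D δ ω) (hR₂ : RightInverseModulus d s₂ 𝒞 L N k D δ ω)
    {V : Site d → Fin d → (Matrix n n ℂ)ˣ} (hV : V ∈ D) (hne : (admissibleS s₁ 𝒞 k V).Nonempty) (hB : BddBelow (levelAction d L N k '' 𝒞 k)) :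
    |sInf (levelAction d L N k '' admissibleS s₁ 𝒞 k V) - sInf (levelAction d L N k '' admissibleS s₂ 𝒞 k V)| ≤ ω := by
  have hne₂ : (admissibleS s₂ 𝒞 k V).Nonempty := nonempty_admissibleS_of_approx hΓ hL hC hE hR₂ hV hne
  have a := sInf_levelAction_admissibleS_le_add hΓ hL hC hE hR₂ hV hne (bddBelow_levelAction_image_admissibleS hB V)
  have b := sInf_levelAction_admissibleS_le_add hΓ hL hC (hE.symm hΓ) hR₁ hV hne₂ (bddBelow_levelAction_image_admissibleS hB V)
  rw [abs_le]
  constructor <;> linarith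

/-- **★★ AGAINST (43)**: for a scheme `s` approximately equivalent to `step42 L` at depth `k` (defect `δ`) with right-inverse moduli `ω` for BOTH (43) and `s` on the data `D`,
on a class with a level-action lower bound, every (43)-admissible datum `V ∈ D` has `|inf A^{(k)}(admissibleS s 𝒞 k V) − minAct d 𝒞 L N k V| ≤ ω`
(`MinimalActionSandwich.minAct` = [Balaban1985Variational] (5)–(6)'s `A_k(V)`; g0's dictionary `admissibleS_step42`). [folklore] -/
theorem abs_sInf_admissibleS_sub_minAct_le (hE : ApproxSchemeGaugeEquivIn d Γ (fun _ => step42 L) s L N k (𝒞 k) δ)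
    (hR43 : RightInverseModulus d (fun _ => step42 L) 𝒞 L N k D δ ω) (hRs : RightInverseModulus d s 𝒞 L N k D δ ω)
    {V : Site d → Fin d → (Matrix n n ℂ)ˣ} (hV : V ∈ D) (hne : (admissible 𝒞 L k V).Nonempty) (hB : BddBelow (levelAction d L N k '' 𝒞 k)) :
    |sInf (levelAction d L N k '' admissibleS s 𝒞 k V) - minAct d 𝒞 L N k V| ≤ ω := by
  rw [← admissibleS_step42] at hne
  have h := abs_sInf_sub_sInf_le hΓ hL hC hE hR43 hRs hV hne hB
  rw [admissibleS_step42] at h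
  rw [abs_sub_comm]
  exact h

end TransferIn

end

end Summit.QuantumFields.YangMills.BalabanUVNodes.N16ApproximateSchemeTransferSub
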